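import Mathlib
import HarnessLib
import Summits.CriticalPhenomena.CardyFormulaZ2.Theses.CardySelfRefinement
import Literature.Probability.RandomPlanarGeometry.ChordalReversibility
import Literature.Probability.RandomPlanarGeometry.ConformalRectangle
import Literature.Probability.RandomPlanarGeometry.IsometryCovariance
import Summits.CriticalPhenomena.CardyFormulaZ2.Theorems.CardySelfRefinementLagHandOffColumnWinding
import Summits.CriticalPhenomena.CardyFormulaZ2.Theorems.CardySelfRefinementLagHandOffColumnEscape
import Summits.CriticalPhenomena.CardyFormulaZ2.Theorems.CardySelfRefinementSymmetryUpgradeRTouchSepCycle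

/-!
# The exploration separates the wired cluster of `a` from the `B`-stretch of the boundary cycle:
a discrete Jordan-curve argument by lattice winding numbers
(helper for L1 `touchExponent_sepDictionary` of stub `stub_touchExponent`, line `SketchIdeatorTwo`,
crux `SymmetryUpgradeR`, stmt-CriticalPhenomena-17239)

`touchExponent_sepDictionary_core` (registered): for admissible square-lattice Dobrushin data on
the carrier of a Jordan domain, a configuration `ω`, a site `v` joined to the `A`-end `a` of
`e_a` by open edges of the completed configuration `bcBondConfig ω`, and a position `1 ≤ t` on
the boundary cycle from `e_a` not beyond the end dart `e_b`, EVERY lattice walk from `v` to the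
boundary vertex at position `t` through edges of `Ω_δ` uses an edge visited by the medial
exploration (Smirnov 2001 §2: the exploration is the interface between the open cluster of the
wired arc and the dual cluster of the free arc).  No planar topology beyond the tree: the closed
lattice walk `e_a · (open path a → v) · σ · (boundary cycle back to the B-end of e_a)` would use
`e_a` exactly once, so its lattice winding numbers (`walkWinding`, `PlanarDuality.lean`, Kesten
1982 §2.2) around the two faces of `e_a` would differ by one (`sepDict_exists_face_walkWinding_ne`);
but both vanish: the outer face of `e_a` ESCAPES to infinity across edges not in `Ω_δ`
(`exists_escape_outerFace`, hole-freeness of Jordan carriers) and the inner face of `e_a` is joined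
to the exit face `o_b` by the dual walk of the faces of the exploration, crossing only CLOSED
VISITED edges (`openConnIn_right_cornerOrbit`), none of them on the walk, and `o_b` escapes too
(`escape_of_not_isInnerFace`); winding numbers are constant along such face walks
(`walkWinding_eq_of_faceWalk_of_closed`).

References: S. Smirnov, C. R. Acad. Sci. Paris 333 (2001), §2; H. Kesten, *Percolation theory
for mathematicians* (1982), §2.2; G. Grimmett, *Percolation* (1999), §11.2.
-/

noncomputable section

namespace Summit.CriticalPhenomena.CardyFormulaZ2.Theorems.SymmetryUpgradeR.SwallowingSkeleton

open MeasureTheory Filter Set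
open Literature.Probability.RandomPlanarGeometry Literature.Probability.LatticeModels
  Literature.Probability.Percolation
open UpperHalfPlane (upperHalfPlaneSet)
open SimpleGraph DiscreteDobrushin
open Summit.CriticalPhenomena.CardyFormulaZ2.Cruxes.LagHandOff.HittingTournament

/-! ### Lattice walks along the boundary cycle -/

/-- Consecutive vertices of the boundary walk are lattice neighbours. -/
theorem sepDict_adj_bwalk (E : DiscreteDobrushin) (d₀ : Site 2 × Fin 4) (n : ℕ) :
    (zdGraph 2).Adj (E.bwalk d₀ n).1 (E.bwalk d₀ (n + 1)).1 := by
  rw [bwalk_fst_succ]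
  exact (SimpleGraph.mem_edgeSet _).1 (cSrc_mem_edgeSet (E.bwalk d₀ n))

/-- **A stretch of the boundary walk as a lattice walk**: from the vertex at position `i` to the
vertex at position `i + j`, with edges the boundary edges `cSrc (bwalk (i + s))`, `s < j`, and
vertices the boundary vertices at positions `i + s`, `s ≤ j`. -/
theorem sepDict_exists_cycleWalk (E : DiscreteDobrushin) (d₀ : Site 2 × Fin 4) (i : ℕ) :
    ∀ j : ℕ, ∃ ψ : (zdGraph 2).Walk (E.bwalk d₀ i).1 (E.bwalk d₀ (i + j)).1,
      (∀ e ∈ ψ.edges, ∃ s < j, e = cSrc (E.bwalk d₀ (i + s))) ∧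
      (∀ x ∈ ψ.support, ∃ s ≤ j, x = (E.bwalk d₀ (i + s)).1)
  | 0 => ⟨Walk.nil, by simp, fun x hx => ⟨0, le_rfl, by simpa using hx⟩⟩
  | j + 1 => by
    obtain ⟨ψ, hψe, hψs⟩ := sepDict_exists_cycleWalk E d₀ i j
    refine ⟨ψ.concat (sepDict_adj_bwalk E d₀ (i + j)), fun e he => ?_, fun x hx => ?_⟩
    · rw [Walk.edges_concat, List.concat_eq_append, List.mem_append, List.mem_singleton] at he
      rcases he with he | rfl
      · obtain ⟨s, hs, rfl⟩ := hψe e he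
        exact ⟨s, Nat.lt_succ_of_lt hs, rfl⟩
      · refine ⟨j, Nat.lt_succ_self j, ?_⟩
        rw [← Nat.add_assoc, bwalk_fst_succ]; rfl
    · rw [Walk.support_concat, List.mem_append, List.mem_singleton] at hx
      rcases hx with hx | rfl
      · obtain ⟨s, hs, rfl⟩ := hψs x hx
        exact ⟨s, Nat.le_succ_of_le hs, rfl⟩
      · exact ⟨j + 1, le_rfl, rfl⟩

/-! ### The jump of the winding number across an edge used exactly once -/

/-- `vCross u` on the upward dart of its own edge is `1`. -/
theorem sepDict_vCross_self (u : Site 2) :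
    vCross u (u + Pi.single 0 1) (u + Pi.single 0 1 + Pi.single 1 1) = 1 := by
  unfold vCross; simp

/-- `vCross u` on the downward dart of its own edge is `-1`. -/
theorem sepDict_vCross_self' (u : Site 2) :
    vCross u (u + Pi.single 0 1 + Pi.single 1 1) (u + Pi.single 0 1) = -1 := by
  unfold vCross; simp

/-- `hCross u` on the rightward dart of its own edge is `1`. -/
theorem sepDict_hCross_self (u : Site 2) :
    hCross u (u + Pi.single 1 1) (u + Pi.single 1 1 + Pi.single 0 1) = 1 := by
  unfold hCross; simp

/-- `hCross u` on the leftward dart of its own edge is `-1`. -/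
theorem sepDict_hCross_self' (u : Site 2) :
    hCross u (u + Pi.single 1 1 + Pi.single 0 1) (u + Pi.single 1 1) = -1 := by
  unfold hCross; simp

/-- **Jump across a vertical edge used once.** If the first dart of a closed lattice walk runs
along the vertical edge `{u + e₀, u + e₀ + e₁}` and no later dart does, the winding numbers of
the walk around the two faces `u`, `u + e₀` of that edge differ. -/
theorem sepDict_walkWinding_ne_right {x y : Site 2} (h : (zdGraph 2).Adj x y)
    (q : (zdGraph 2).Walk y x) (u : Site 2)
    (hxy : s(x, y) = s(u + Pi.single 0 1, u + Pi.single 0 1 + Pi.single 1 1))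
    (hq : ∀ e ∈ q.edges, e ≠ s(u + Pi.single 0 1, u + Pi.single 0 1 + Pi.single 1 1)) :
    walkWinding (Walk.cons h q) u ≠ walkWinding (Walk.cons h q) (u + Pi.single 0 1) := by
  have key := walkWinding_sub_walkWinding_right (Walk.cons h q) u
  rw [Walk.darts_cons, List.map_cons, List.sum_cons] at key
  have hrest : (q.darts.map fun d => vCross u d.toProd.1 d.toProd.2).sum = 0 := by
    refine List.sum_eq_zero fun t ht => ?_
    obtain ⟨d, hd, rfl⟩ := List.mem_map.1 ht
    exact vCross_eq_zero_of_ne (hq _ (List.mem_map.2 ⟨d, hd, rfl⟩))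
  rw [hrest, add_zero] at key
  have hv : vCross u x y = 1 ∨ vCross u x y = -1 := by
    rcases Sym2.eq_iff.1 hxy with ⟨rfl, rfl⟩ | ⟨rfl, rfl⟩
    · exact Or.inl (sepDict_vCross_self u)
    · exact Or.inr (sepDict_vCross_self' u)
  intro heq
  change walkWinding (Walk.cons h q) u - walkWinding (Walk.cons h q) (u + Pi.single 0 1) =
    vCross u x y at key
  rcases hv with hv | hv <;> rw [hv] at key <;> omega

/-- **Jump across a horizontal edge used once** (closed walk: the half-line boundary terms
cancel). -/
theorem sepDict_walkWinding_ne_up {x y : Site 2} (h : (zdGraph 2).Adj x y)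
    (q : (zdGraph 2).Walk y x) (u : Site 2)
    (hxy : s(x, y) = s(u + Pi.single 1 1, u + Pi.single 1 1 + Pi.single 0 1))
    (hq : ∀ e ∈ q.edges, e ≠ s(u + Pi.single 1 1, u + Pi.single 1 1 + Pi.single 0 1)) :
    walkWinding (Walk.cons h q) u ≠ walkWinding (Walk.cons h q) (u + Pi.single 1 1) := by
  have key := walkWinding_sub_walkWinding_up (Walk.cons h q) u
  rw [Walk.darts_cons, List.map_cons, List.sum_cons, sub_self, neg_zero, zero_sub] at key
  have hrest : (q.darts.map fun d => hCross u d.toProd.1 d.toProd.2).sum = 0 := by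
    refine List.sum_eq_zero fun t ht => ?_
    obtain ⟨d, hd, rfl⟩ := List.mem_map.1 ht
    exact hCross_eq_zero_of_ne (hq _ (List.mem_map.2 ⟨d, hd, rfl⟩))
  rw [hrest, add_zero] at key
  have hv : hCross u x y = 1 ∨ hCross u x y = -1 := by
    rcases Sym2.eq_iff.1 hxy with ⟨rfl, rfl⟩ | ⟨rfl, rfl⟩
    · exact Or.inl (sepDict_hCross_self u)
    · exact Or.inr (sepDict_hCross_self' u)
  intro heq
  change walkWinding (Walk.cons h q) u - walkWinding (Walk.cons h q) (u + Pi.single 1 1) =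
    -hCross u x y at key
  rcases hv with hv | hv <;> rw [hv] at key <;> omega

/-- Every lattice edge `{x, x + cornerUnit k}` is the vertical edge `{u + e₀, u + e₀ + e₁}` or the
horizontal edge `{u + e₁, u + e₁ + e₀}` of some base face `u`. -/
theorem sepDict_edge_cases (x : Site 2) (k : Fin 4) :
    (∃ u : Site 2, s(x, x + cornerUnit k) = s(u + Pi.single 0 1, u + Pi.single 0 1 + Pi.single 1 1)) ∨
    (∃ u : Site 2, s(x, x + cornerUnit k) = s(u + Pi.single 1 1, u + Pi.single 1 1 + Pi.single 0 1)) := by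
  have h0 : cornerUnit 0 = Pi.single 0 1 := rfl
  have h1 : cornerUnit 1 = Pi.single 1 1 := rfl
  have h2 : cornerUnit 2 = -Pi.single 0 1 := rfl
  have h3 : cornerUnit 3 = -Pi.single 1 1 := rfl
  obtain rfl | rfl | rfl | rfl : k = 0 ∨ k = 1 ∨ k = 2 ∨ k = 3 := by fin_cases k <;> simp
  · right
    refine ⟨x - Pi.single 1 1, ?_⟩
    rw [h0]; exact congrArg₂ (fun a b => s(a, b)) (by abel) (by abel)
  · left
    refine ⟨x - Pi.single 0 1, ?_⟩
    rw [h1]; exact congrArg₂ (fun a b => s(a, b)) (by abel) (by abel)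
  · right
    refine ⟨x - Pi.single 0 1 - Pi.single 1 1, ?_⟩
    rw [h2, Sym2.eq_swap]; exact congrArg₂ (fun a b => s(a, b)) (by abel) (by abel)
  · left
    refine ⟨x - Pi.single 0 1 - Pi.single 1 1, ?_⟩
    rw [h3, Sym2.eq_swap]; exact congrArg₂ (fun a b => s(a, b)) (by abel) (by abel)

/-- The two faces of the vertical edge `{u + e₀, u + e₀ + e₁}` are `u` and `u + e₀`: both have its
endpoints as corners. -/
theorem sepDict_isCorner_vertical (u : Site 2) :
    IsCorner (u + Pi.single 0 1) u ∧ IsCorner (u + Pi.single 0 1 + Pi.single 1 1) u ∧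
    IsCorner (u + Pi.single 0 1) (u + Pi.single 0 1) ∧
    IsCorner (u + Pi.single 0 1 + Pi.single 1 1) (u + Pi.single 0 1) := by
  refine ⟨?_, ?_, isCorner_self _, ?_⟩
  · intro i; fin_cases i <;> simp
  · intro i; fin_cases i <;> simp
  · intro i; fin_cases i <;> simp

/-- The two faces of the horizontal edge `{u + e₁, u + e₁ + e₀}` are `u` and `u + e₁`. -/
theorem sepDict_isCorner_horizontal (u : Site 2) :
    IsCorner (u + Pi.single 1 1) u ∧ IsCorner (u + Pi.single 1 1 + Pi.single 0 1) u ∧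
    IsCorner (u + Pi.single 1 1) (u + Pi.single 1 1) ∧
    IsCorner (u + Pi.single 1 1 + Pi.single 0 1) (u + Pi.single 1 1) := by
  refine ⟨?_, ?_, isCorner_self _, ?_⟩
  · intro i; fin_cases i <;> simp
  · intro i; fin_cases i <;> simp
  · intro i; fin_cases i <;> simp

/-- **Jump across an edge used once, face form.** If the first dart of a closed lattice walk runs
along the lattice edge `{x, x + cornerUnit k}` and no later dart does, then the walk cannot wind
`0` times around every face having both endpoints of that edge as corners. -/
theorem sepDict_exists_face_walkWinding_ne {x₀ y₀ : Site 2} (h : (zdGraph 2).Adj x₀ y₀)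
    (q : (zdGraph 2).Walk y₀ x₀) (x : Site 2) (k : Fin 4)
    (hxy : s(x₀, y₀) = s(x, x + cornerUnit k))
    (hq : ∀ e ∈ q.edges, e ≠ s(x, x + cornerUnit k))
    (hW : ∀ F : Site 2, IsCorner x F → IsCorner (x + cornerUnit k) F →
      walkWinding (Walk.cons h q) F = 0) : False := by
  rcases sepDict_edge_cases x k with ⟨u, hu⟩ | ⟨u, hu⟩
  · obtain ⟨h1, h2, h3, h4⟩ := sepDict_isCorner_vertical u
    have hc : ∀ F, IsCorner (u + Pi.single 0 1) F → IsCorner (u + Pi.single 0 1 + Pi.single 1 1) F →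
        IsCorner x F ∧ IsCorner (x + cornerUnit k) F := by
      intro F hF hF'
      rcases Sym2.eq_iff.1 hu with ⟨e1, e2⟩ | ⟨e1, e2⟩
      · exact ⟨e1 ▸ hF, e2 ▸ hF'⟩
      · exact ⟨e1 ▸ hF', e2 ▸ hF⟩
    refine sepDict_walkWinding_ne_right h q u (hxy.trans hu) (fun e he => hu ▸ hq e he) ?_
    rw [hW u (hc u h1 h2).1 (hc u h1 h2).2, hW _ (hc _ h3 h4).1 (hc _ h3 h4).2]
  · obtain ⟨h1, h2, h3, h4⟩ := sepDict_isCorner_horizontal u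
    have hc : ∀ F, IsCorner (u + Pi.single 1 1) F → IsCorner (u + Pi.single 1 1 + Pi.single 0 1) F →
        IsCorner x F ∧ IsCorner (x + cornerUnit k) F := by
      intro F hF hF'
      rcases Sym2.eq_iff.1 hu with ⟨e1, e2⟩ | ⟨e1, e2⟩
      · exact ⟨e1 ▸ hF, e2 ▸ hF'⟩
      · exact ⟨e1 ▸ hF', e2 ▸ hF⟩
    refine sepDict_walkWinding_ne_up h q u (hxy.trans hu) (fun e he => hu ▸ hq e he) ?_
    rw [hW u (hc u h1 h2).1 (hc u h1 h2).2, hW _ (hc _ h3 h4).1 (hc _ h3 h4).2]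


/-! ### The discrete dictionary: the exploration separates the wired cluster of `a` from the
`B`-stretch of the boundary cycle -/

/-- **Core separation theorem (discrete Jordan curve argument by lattice winding numbers).**
Admissible square-lattice Dobrushin data `E` on the carrier of a Jordan domain, a configuration
`ω`, the exploration (cut orbit of `E.bcBondConfig ω` from the start corner `e_a`); a site `v`
joined to the `A`-end of `e_a` by open edges of the completed configuration; a position `t ≥ 1` on
the boundary cycle from `e_a` not beyond the end dart `e_b`. Then EVERY lattice walk `σ` from `v`
to the boundary vertex at position `t` through edges of `Ω_δ` uses an edge visited by the
exploration. Proof: otherwise the closed lattice walk `e_a · (open path a → v) · σ · (boundary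
cycle backwards to the B-end of e_a)` uses `e_a` exactly once, so its winding numbers around the
two faces of `e_a` differ by one; but both vanish: the outer face of `e_a` escapes to infinity
across edges not in `Ω_δ`, and the inner face is joined to the exit face `o_b` by the dual path of
the faces of the exploration (crossing only closed VISITED edges, none of them on the walk) and
`o_b` escapes as well. -/
theorem touchExponent_sepDictionary_core : ∀ (J : JordanDomain) (E : DiscreteDobrushin), E.Ω = J.carrier → ∀ (hE : E.IsZdAdmissible) (ω : BondConfig (Site 2)) (v : Site 2) (t : ℕ) (σ : (zdGraph 2).Walk v (E.bwalk (DiscreteDobrushin.startCorner hE) t).1), 1 ≤ t → (∀ s < t, E.bwalk (DiscreteDobrushin.startCorner hE) s ≠ DiscreteDobrushin.ebDart hE) → E.bcBondConfig ω ∈ openConnIn Set.univ (DiscreteDobrushin.startCorner hE).1 v → (∀ e ∈ σ.edges, e ∈ (discreteDomainGraph E.Ω E.δ).edgeSet) → ∃ e ∈ σ.edges, ∃ n ≤ DiscreteDobrushin.exitTime hE ω, e = cSrc (cornerOrbit (E.bcBondConfig ω) (DiscreteDobrushin.startCorner hE) n) := by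
  intro J E hΩ hE ω v t σ ht htb hv hσ
  classical
  by_contra hfar
  push Not at hfar
  have hreg := regular_of_eq_carrier (D := E) J hΩ
  have hc₀ : E.IsStartCorner (startCorner hE) := isStartCorner_startCorner hE
  set β := E.bcBondConfig ω with hβ
  set G := discreteDomainGraph E.Ω E.δ with hG
  set N := exitTime hE ω with hN
  have hδ : 0 < E.δ := hE.delta_pos
  have hGle : G ≤ zdGraph 2 :=
    (discreteDomainGraph_le_meshGraph _ _).trans (meshGraph_le_zdGraph _ _)
  have hβG : β ⊆ G.edgeSet := E.bcBondConfig_subset ω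
  have hβzd : β ⊆ (zdGraph 2).edgeSet := fun e he => edgeSet_subset_edgeSet.2 hGle (hβG he)
  -- `t` lies before the end dart, in particular within the period
  obtain ⟨tb, htbP, htbeq⟩ := exists_bwalk_eq_ebDart hE hreg.1 hreg.2.1 hreg.2.2.1 hreg.2.2.2
  have httb : t ≤ tb := by
    by_contra h
    exact htb tb (by omega) htbeq
  -- (1) the open walk from `a` to `v`
  obtain ⟨π, -, hπ⟩ := exists_walk_of_mem_openConnIn hβzd hv
  -- (2) the boundary stretch from `b' = (bwalk 1).1` to `(bwalk t).1`
  obtain ⟨ψ, hψe, hψs⟩ := sepDict_exists_cycleWalk E (startCorner hE) 1 (t - 1)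
  have h1t : 1 + (t - 1) = t := by omega
  have hb' : (E.bwalk (startCorner hE) 1).1 = (startCorner hE).1 + cornerUnit (startCorner hE).2 := by
    rw [bwalk_fst_succ]; rfl
  have hab : (zdGraph 2).Adj ((startCorner hE).1 + cornerUnit (startCorner hE).2) (startCorner hE).1 :=
    ((SimpleGraph.mem_edgeSet _).1 (cSrc_mem_edgeSet (startCorner hE))).symm
  -- the closed walk `Pw = e_a · π · σ · ψ⁻¹` based at `b'`
  set ρ : (zdGraph 2).Walk (startCorner hE).1 ((startCorner hE).1 + cornerUnit (startCorner hE).2) :=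
    π.append (σ.append ((ψ.reverse).copy (by rw [h1t]) hb')) with hρ
  set Pw : (zdGraph 2).Walk ((startCorner hE).1 + cornerUnit (startCorner hE).2) ((startCorner hE).1 + cornerUnit (startCorner hE).2) := Walk.cons hab ρ
    with hPw
  have hρe : ∀ e ∈ ρ.edges, e ∈ π.edges ∨ e ∈ σ.edges ∨ e ∈ ψ.edges := by
    intro e he
    rw [hρ, Walk.edges_append, Walk.edges_append, Walk.edges_copy, Walk.edges_reverse,
      List.mem_append, List.mem_append, List.mem_reverse] at he
    exact he
  have hPwe : ∀ e ∈ Pw.edges, e = cSrc (startCorner hE) ∨ e ∈ ρ.edges := by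
    intro e he
    rw [hPw, Walk.edges_cons, List.mem_cons] at he
    rcases he with rfl | he
    · left; rw [cSrc, Sym2.eq_swap]
    · exact Or.inr he
  -- every edge of `Pw` is an edge of `Ω_δ`
  have heaG : cSrc (startCorner hE) ∈ G.edgeSet := hc₀.isOutEdge.isFaceBoundaryEdge.1
  have hψG : ∀ e ∈ ψ.edges, e ∈ G.edgeSet := by
    intro e he
    obtain ⟨s, -, rfl⟩ := hψe e he
    exact (isOutEdge_bwalk hc₀.isOutEdge (1 + s)).isFaceBoundaryEdge.1
  have hPwG : ∀ e ∈ Pw.edges, e ∈ G.edgeSet := by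
    intro e he
    rcases hPwe e he with rfl | he
    · exact heaG
    · rcases hρe e he with he | he | he
      · exact hβG (hπ e he)
      · exact hσ e he
      · exact hψG e he
  -- every vertex of `Pw` lies in `Ω_δ`
  have hmemG : ∀ e ∈ G.edgeSet, ∀ z ∈ e, z ∈ meshDomain E.Ω E.δ := by
    intro e he z hz
    have h' : s(z, Sym2.Mem.other hz) ∈ G.edgeSet := by rwa [Sym2.other_spec hz]
    exact (discreteDomainGraph_adj_iff.1 ((SimpleGraph.mem_edgeSet _).1 h')).2.1
  have hPwsupp : ∀ z ∈ Pw.support, z ∈ meshDomain E.Ω E.δ := by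
    intro z hz
    rcases Walk.mem_support_iff_exists_mem_edges.1 hz with rfl | ⟨e, he, hze⟩
    · exact hmemG _ heaG _ (by rw [cSrc]; exact Sym2.mem_mk_right _ _)
    · exact hmemG e (hPwG e he) z hze
  -- (3) the dual walk of the faces of the exploration, from the inner face of `e_a` to `o_b`
  set T : Set (Sym2 (Site 2)) :=
    {e | ∃ m < N, cTgt (cornerOrbit β (startCorner hE) m) ∉ β ∧ e = dualEdge (cTgt (cornerOrbit β (startCorner hE) m))} with hT
  have hR := openConnIn_right_cornerOrbit (β := β) (c₀ := startCorner hE) Set.univ T N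
    (fun _ _ => Set.mem_univ _) (fun m hm hcl => ⟨m, hm, hcl, rfl⟩)
  obtain ⟨Q₁, -, hQ₁⟩ := exists_walk_of_mem_openConnIn (G := zdGraph 2)
    (fun e he => (mem_dualConfig_iff.1 he.1).1) hR
  -- (4) escapes of the two outer faces
  obtain ⟨X₁, X₂, Y₁, Y₂, hbox⟩ := exists_box_meshDomain hE.isBounded hδ
  obtain ⟨gb, hgb, hchain⟩ :=
    escape_of_not_isInnerFace J hΩ hδ (cFace (cornerOrbit β (startCorner hE) N)) (not_isInnerFace_exitTime hE ω) Y₂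
  obtain ⟨εb, hεb⟩ := exists_walk_of_reflTransGen_esc hchain
  obtain ⟨ga, εa, hεa, htopa⟩ := exists_escape_outerFace J hΩ hE hc₀
  -- (5) no dart of the dual walk crosses an edge of `Pw`
  have hQ₁' : ∀ dq ∈ Q₁.darts, sepEdge dq.toProd.1 dq.toProd.2 ∉ Pw.edges := by
    intro dq hdq hmem
    have hedge : s(dq.toProd.1, dq.toProd.2) ∈ dualConfig β ∩ T :=
      hQ₁ _ (List.mem_map.2 ⟨dq, hdq, rfl⟩)
    obtain ⟨m, hm, hcl, heq⟩ := hedge.2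
    have hsep : sepEdge dq.toProd.1 dq.toProd.2 = cTgt (cornerOrbit β (startCorner hE) m) := by
      apply dualEdge_bijective.1
      rw [dualEdge_sepEdge dq.adj, heq]
    rw [hsep, ← cSrc_cornerOrbit_succ] at hmem
    rcases hPwe _ hmem with h | h
    · exact sepDict_cSrc_cornerOrbit_ne_start hE ω (n := m + 1) (by omega) (by omega) h
    rcases hρe _ h with h | h | h
    · rw [cSrc_cornerOrbit_succ] at h
      exact hcl (hπ _ h)
    · exact hfar _ h (m + 1) (by omega) rfl
    · obtain ⟨s, hs, hseq⟩ := hψe _ h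
      rcases Nat.lt_or_ge (m + 1) N with hmN | hmN
      · -- two inner faces: not a face-boundary edge
        rw [cSrc_cornerOrbit_succ] at hseq
        refine sepDict_cSrc_ne_cTgt_of_inner (E := E) (x := (cornerOrbit β (startCorner hE) m).1)
          (k := (cornerOrbit β (startCorner hE) m).2) (isInnerFace_of_lt_exitTime hE ω hm) ?_
          (isOutEdge_bwalk hc₀.isOutEdge (1 + s)) hseq.symm
        have := isInnerFace_of_lt_exitTime hE ω hmN
        rwa [cornerOrbit_succ, cFace_nextCorner_of_not_mem hcl] at this
      · -- the exit edge `e_b`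
        have hmN' : m + 1 = N := le_antisymm hm hmN
        have heb : cSrc (cornerOrbit β (startCorner hE) (m + 1)) = cSrc (ebDart hE) := by
          rw [← ebDart'_eq_ebDart hE ω, cSrc_ebDart', lastCorner, cSrc_cornerOrbit_succ]
          congr 2; omega
        rw [heb] at hseq
        exact htb (1 + s) (by omega)
          (eq_of_isOutEdge_of_cSrc_eq (isOutEdge_bwalk hc₀.isOutEdge (1 + s)) (isOutEdge_ebDart hE)
            hseq.symm)
  -- (6) the winding numbers of `Pw` around the two faces of `e_a` vanish
  have hW0 : walkWinding Pw (cFace (startCorner hE)) = 0 := by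
    rw [walkWinding_eq_of_faceWalk_of_closed Pw (Q₁.append εb) ?_]
    · exact walkWinding_eq_zero_of_le (fun z hz => (hbox z (hPwsupp z hz)).2.2.2) hgb
    · intro dq hdq
      rw [Walk.darts_append, List.mem_append] at hdq
      rcases hdq with hdq | hdq
      · exact hQ₁' dq hdq
      · exact fun h => hεb dq hdq (hPwG _ h)
  have hW0' : walkWinding Pw (faceAt (startCorner hE).1 ((startCorner hE).2 + 3)) = 0 := by
    rw [walkWinding_eq_of_faceWalk_of_closed Pw εa (fun dq hdq h => hεa dq hdq (hPwG _ h))]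
    exact walkWinding_eq_zero_of_le (fun z hz => htopa z (hPwsupp z hz)) le_rfl
  -- (7) but `Pw` uses `e_a` exactly once: contradiction
  refine sepDict_exists_face_walkWinding_ne hab ρ (startCorner hE).1 (startCorner hE).2 (by rw [Sym2.eq_swap]) ?_ ?_
  · -- no later dart runs along `e_a`
    intro e he heq
    rcases hρe e he with h | h | h
    · exact cSrc_start_not_mem hE hc₀ (heq ▸ hπ e h)
    · exact hfar e h 0 (Nat.zero_le _) heq
    · obtain ⟨s, hs, rfl⟩ := hψe e h
      have h0 := eq_of_isOutEdge_of_cSrc_eq (isOutEdge_bwalk hc₀.isOutEdge (1 + s)) hc₀.isOutEdge heq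
      have := bwalk_injOn hE hc₀.isOutEdge (i := 1 + s) (j := 0) (by omega) (bperiod_pos _ _)
        (by rw [h0]; rfl)
      omega
  · -- the faces of `e_a` are its inner face and its outer face
    intro F hF hF'
    obtain ⟨i, rfl⟩ := exists_faceAt_of_isCorner hF
    rcases (isCorner_add_faceAt_iff (startCorner hE).1 (startCorner hE).2 i).1 hF' with rfl | rfl
    · exact hW0
    · exact hW0'

end Summit.CriticalPhenomena.CardyFormulaZ2.Theorems.SymmetryUpgradeR.SwallowingSkeleton

end
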